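import Literature.IUT.HodgeTheaters.PlaceKitTruncation
import Literature.IUT.HodgeTheaters.TruncatedPlaceKitCofinal
import HarnessLib

/-!
# The truncations of ONE place kit form a RESTRICTION SYSTEM over the admissible `S` (β → α, proof-only)

Mochizuki, *Inter-universal Teichmüller Theory I*, kurims manuscript (May 2020), §3 Def 3.1 (e) p.62
("`V̲ ⊆ V(K)` is a subset that induces a natural bijection `V̲ ⥲ V_mod`"), §6 Def 6.1 pp.155–159
[cite: Mochizuki2012, I Def 3.1 (e) p.62, I Def 6.1 p.155] (D-0012 claim key, status disputed; BRIDGE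
plumbing between two landed typings of the cell — nothing of the series is asserted, no side is taken on
[IUTchIII] Cor. 3.12).

MERGE-MAP plan/L6/MERGE-MAP.md §4 C9-d / RULING D13.  abc-iut-L5-t4's (β) bridge of record
`InitialThetaData.PlaceKit` (`PlaceKitBridge.lean`, p415508: a kit whose index set IS the infinite `V̲`) and
abc-iut-L6-t7's comparison `PlaceKit.restrict S : TruncatedKit D S` (`PlaceKitTruncation.lean`, p415990) say
that every decl READ over the (α) family of truncated kits (`TruncatedPlaceKitBridge.lean`) is an instance
of its (β) reading.  The (α) family is not a bare family but a SYSTEM: it comes with the restriction law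
`TruncatedKit.Restriction` along `S ⊆ S′` and with cofinality (`TruncatedPlaceKitCofinal.lean`).  This
proof-only file (no definitions, no new `Prop` facts) records that the truncations of one place kit inherit
exactly that structure, so that nothing written over the SYSTEM of truncated kits is lost on the (β) side:

* `PlaceKit.restrict_mem_arc_iff` — the archimedean indices of `T.restrict S` are the indices whose
  valuation is archimedean for `T` (companion of L6-t7's `restrict_mem_bad_iff`);
* `PlaceKit.restrict_val_mem_VOver` / `restrict_val_surjOn` — `T.restrict S` indexes EXACTLY `V̲_S`;
* `PlaceKit.nonempty_restriction_restrict` — for `S ⊆ S′` the truncations `T.restrict S`, `T.restrict S′`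
  of ONE place kit are linked by a `TruncatedKit.Restriction` (index map = the inclusion `V̲_S ↪ V̲_{S′}` read
  through the enumerations; ambient categories and models identified ON THE NOSE, both being the place
  kit's at the same index of `V̲`);
* `PlaceKit.exists_admissible_restrict_val_eq` — β-level COFINALITY: every index of the place kit is seen
  by the truncation at some admissible `S` (from L6-t7's `exists_admissible_mem_VOver`).

Second-reader note (RQ7, abc-iut-L5-t4 on p415990): every statement below elaborates against the landed
`PlaceKit.restrict` by definitional unfolding only (`restrict_val`, `restrict_Amb`, `restrict_model` are
`rfl` in p415990), i.e. this file is also a kernel probe of p415990.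
-/

namespace Literature.IUT.HodgeTheaters

open CategoryTheory

universe uK u v w

section Places

variable {F : Type u} {K : Type v} {Fbar : Type w} [Field F] [NumberField F] [Field K]
  [NumberField K] [Algebra F K] [Field Fbar] [Algebra F Fbar] [Algebra K Fbar]
  {E : WeierstrassCurve F} [E.IsElliptic] {l : ℕ} {P : BadPlacePredicates K}
  {D : InitialThetaData F K Fbar E l P}

namespace InitialThetaData

namespace PlaceKit

/-- **IUTchI:Def3.1(e)** (kurims p.62) The archimedean indices of the restriction are exactly the indices whose
valuation is archimedean for the place kit (companion of `restrict_mem_bad_iff`; the truncation loses no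
archimedean index when `S` is admissible: `TruncatedKit.val_image_arc`). [claim: Mochizuki2012, status: disputed] -/
theorem restrict_mem_arc_iff (T : PlaceKit.{uK} D) (S : Finset (Val (fieldOfModuli E)))
    (i : (T.restrict S).kit.V) :
    i ∈ (T.restrict S).kit.arc ↔
      T.e.symm ⟨(T.restrict S).val i, (T.restrict S).val_mem_V i⟩ ∈ T.kit.arc := by
  rw [(T.restrict S).mem_arc_iff, T.mem_arc_iff, Equiv.apply_symm_apply]
  rfl

/-- **IUTchI:Def3.1(e)** (kurims p.62) The restriction at `S` indexes valuations of `V̲_S` … [claim: Mochizuki2012, status: disputed] -/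
theorem restrict_val_mem_VOver (T : PlaceKit.{uK} D) (S : Finset (Val (fieldOfModuli E)))
    (i : (T.restrict S).kit.V) :
    (T.restrict S).val i ∈ D.VOver (S : Set (Val (fieldOfModuli E))) :=
  ((T.restrict S).e i).2

/-- **IUTchI:Def3.1(e)** (kurims p.62) … and ALL of them: `val` maps the index set of `T.restrict S` onto `V̲_S`
(with `TruncatedKit.val_injective`: bijectively). [claim: Mochizuki2012, status: disputed] -/
theorem restrict_val_surjOn (T : PlaceKit.{uK} D) (S : Finset (Val (fieldOfModuli E))) :
    Set.SurjOn (T.restrict S).val Set.univ (D.VOver (S : Set (Val (fieldOfModuli E)))) := by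
  intro w hw
  refine ⟨(T.restrict S).e.symm ⟨w, hw⟩, Set.mem_univ _, ?_⟩
  change (((T.restrict S).e ((T.restrict S).e.symm ⟨w, hw⟩) : D.VOver _) : Val K) = w
  rw [Equiv.apply_symm_apply]

/-- **IUTchI:Def6.1** (kurims p.156) **The truncations of one place kit form a restriction system.** For `S ⊆ S′`
there is a restriction datum `TruncatedKit.Restriction (T.restrict S) (T.restrict S′)` (abc-iut-L6-t7's law of
the (α) family): its index map sends an index of `V̲_S` to the index of `V̲_{S′}` naming the SAME valuation, and
at corresponding indices the ambient categories and the models `𝒟_v` are those of the place kit at one and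
the same index of `V̲` — identified by the identity. PROVED (no hypothesis on `S`, `S′` beyond `S ⊆ S′`).
[claim: Mochizuki2012, status: disputed] -/
theorem nonempty_restriction_restrict (T : PlaceKit.{uK} D) {S S' : Finset (Val (fieldOfModuli E))}
    (h : S ⊆ S') : Nonempty (TruncatedKit.Restriction (T.restrict S) (T.restrict S')) := by
  classical
  -- the inclusion `V̲_S ⊆ V̲_{S′}`
  have hW : D.VOver (S : Set (Val (fieldOfModuli E))) ⊆ D.VOver (S' : Set (Val (fieldOfModuli E))) :=
    D.VOver_mono (Finset.coe_subset.2 h)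
  -- the index map, read through the two enumerations
  let res : (T.restrict S).kit.V → (T.restrict S').kit.V := fun i =>
    (T.restrict S').e.symm (Set.inclusion hW ((T.restrict S).e i))
  -- it preserves the valuation
  have hval : ∀ i, (T.restrict S').val (res i) = (T.restrict S).val i := by
    intro i
    change (((T.restrict S').e ((T.restrict S').e.symm _) : D.VOver _) : Val K) = _
    rw [Equiv.apply_symm_apply]
    rfl
  -- hence corresponding indices name the same index of `V̲` in the place kit
  have hidx : ∀ i,
      T.e.symm ⟨(T.restrict S).val i, (T.restrict S).val_mem_V i⟩ =
        T.e.symm ⟨(T.restrict S').val (res i), (T.restrict S').val_mem_V (res i)⟩ := by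
    intro i
    congr 1
    exact Subtype.ext (hval i).symm
  -- an equality of indices of the place kit gives an equivalence of ambient categories carrying model to model
  have key : ∀ x y : T.kit.V, x = y →
      ∃ Φ : T.kit.Amb x ≌ T.kit.Amb y, Nonempty (Φ.functor.obj (T.kit.model x) ≅ T.kit.model y) := by
    rintro x _ rfl
    exact ⟨CategoryTheory.Equivalence.refl, ⟨Iso.refl _⟩⟩
  refine ⟨{ res := ⟨res, fun i j hij => ?_⟩
            val_res := hval
            ambEquiv := fun i => (key _ _ (hidx i)).choose
            ambEquiv_model := fun i => (key _ _ (hidx i)).choose_spec.some }⟩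
  -- injectivity of the index map: it preserves valuations and `val` is injective
  apply (T.restrict S).val_injective
  rw [← hval i, ← hval j]
  exact congrArg _ hij

/-- **IUTchI:Def3.1(e)** (kurims p.62) **β-level cofinality**: every index of a place kit (i.e. every `v̲ ∈ V̲`) is
seen by its restriction to SOME admissible truncation `S` — the (α) readings over admissible truncations
jointly exhaust the place kit (abc-iut-L6-t7's `exists_admissible_mem_VOver`). [claim: Mochizuki2012, status: disputed] -/
theorem exists_admissible_restrict_val_eq (T : PlaceKit.{uK} D) (x : T.kit.V) :
    ∃ S : Finset (Val (fieldOfModuli E)), D.IsAdmissibleTruncation S ∧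
      ∃ i : (T.restrict S).kit.V, (T.restrict S).val i = T.val x := by
  obtain ⟨S, hS, hxS⟩ := D.exists_admissible_mem_VOver (T.val_mem_V x)
  obtain ⟨i, -, hi⟩ := T.restrict_val_surjOn S hxS
  exact ⟨S, hS, i, hi⟩

/-- **IUTchI:Def3.1(e)** (kurims p.62) Conversely every index of every truncation of a place kit names an index of the
place kit with the same valuation (the restriction changes nothing but the index set; `restrict_val_eq`).
[claim: Mochizuki2012, status: disputed] -/
theorem exists_index_val_eq_restrict_val (T : PlaceKit.{uK} D) (S : Finset (Val (fieldOfModuli E)))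
    (i : (T.restrict S).kit.V) : ∃ x : T.kit.V, T.val x = (T.restrict S).val i :=
  ⟨T.e.symm ⟨(T.restrict S).val i, (T.restrict S).val_mem_V i⟩, (T.restrict_val_eq S i).symm⟩

end PlaceKit

end InitialThetaData

end Places

end Literature.IUT.HodgeTheaters
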